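import Literature.Probability.RandomPlanarGeometry.HexSAWArcFibreBound
import Literature.Probability.RandomPlanarGeometry.PolylineShellTraversals
import Literature.Probability.RandomPlanarGeometry.EmbSAWLawSums
import Mathlib.Data.List.TakeWhile
import HarnessLib

/-!
# Virginization (I): cutting walks at the far prefix/suffix, the event on the vertex sequence, doors

The exact bookkeeping ("VIRGINIZATION") that turns Aizenman–Burchard-type shell bounds for
`x`-weighted self-avoiding ARCS between two DOORS on a circle bounding a VIRGIN lattice disc
(complete honeycomb inside, arbitrary vertex set and edge set outside) into the same bounds for
the `x^{#vertices}`-weighted self-avoiding WALKS of a discrete domain `Ω_δ ⊆ δℍ`; this first file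
collects the instance-free tools, the two reductions are `sum_vertexTraversals_le_chordal`
(`HexSAWVirginizationChordal.lean`) and `sum_vertexTraversals_le_rooted`
(`HexSAWVirginizationRooted.lean`). Two-sided domain Markov property (Duminil-Copin–Smirnov 2012
§2; `HexSAWArcDecomposition.lean`, `HexSAWArcFibreBound.lean`) + transport of the traversal event
to the middle piece (`PolylineShellTraversals.lean`, AB99 §3.a). All notions (virgin disc, doors,
the arc event) are written out; no new definitions.

* `decomp_far`, `decomp_far_rooted` — the cut of a vertex list at its maximal far prefix /
  suffix (`List.takeWhile` / `List.dropWhile`), with all the structural facts;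
* `not_vertexTraversals_far_append_singleton` — a far list followed by one point has no two
  vertex traversals;
* `vertexTraversals_of_hasTraversals_toCurve` — separate traversals of the rescaled SAW polyline
  give weak vertex traversals of its vertex sequence (lattice units);
* `isChain_sup_disc_iff` — arcs through a door into `Ω_δ` of the graph `Ω_δ` enlarged inside a
  disc are arcs of `Ω_δ`;
* `support_subset_embMeshDomain_of_ne`, `mem_filter_univ_of_pred`, `exists_reverse_event_le` —
  supports lie in `Ω_δ`; instance-free filter membership; reversal of the walks.
-/

noncomputable section

open scoped Classical
open Literature.Probability.LatticeModels

namespace Literature.Probability.RandomPlanarGeometry.SAW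

/-! ### Cutting a list at its maximal far prefix and suffix -/

section Decomp

variable {V : Type*} (far : V → Bool)

/-- **The cut at the first and last near vertex.** If the first and last elements of `L` are
far and some element is near, then `L = β ++ (mid ++ suf)` with `β = takeWhile far L ≠ []` far,
`suf` (the maximal far suffix of the rest) `≠ []` far, and `mid ≠ []` starting and ending at near
elements. [folklore] -/
theorem decomp_far {L : List V} (hL : L ≠ []) (hhead : far (L.head hL) = true)
    (hlast : far (L.getLast hL) = true) (hnear : ∃ v ∈ L, far v = false) :
    L.takeWhile far ≠ [] ∧ L.dropWhile far ≠ [] ∧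
    ((L.dropWhile far).reverse.dropWhile far).reverse ≠ [] ∧
    ((L.dropWhile far).reverse.takeWhile far).reverse ≠ [] ∧
    L = L.takeWhile far ++ (((L.dropWhile far).reverse.dropWhile far).reverse ++
      ((L.dropWhile far).reverse.takeWhile far).reverse) ∧
    (∀ v ∈ L.takeWhile far, far v = true) ∧
    (∀ v ∈ ((L.dropWhile far).reverse.takeWhile far).reverse, far v = true) ∧
    (∀ h : ((L.dropWhile far).reverse.dropWhile far).reverse ≠ [],
      far ((((L.dropWhile far).reverse.dropWhile far).reverse).head h) = false) ∧
    (∀ h : ((L.dropWhile far).reverse.dropWhile far).reverse ≠ [],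
      far ((((L.dropWhile far).reverse.dropWhile far).reverse).getLast h) = false) := by
  set β := L.takeWhile far with hβ
  set rest := L.dropWhile far with hrest
  set mid := (rest.reverse.dropWhile far).reverse with hmid
  set suf := (rest.reverse.takeWhile far).reverse with hsuf
  have hLβ : L = β ++ rest := (List.takeWhile_append_dropWhile (p := far) (l := L)).symm
  have hrest_eq : rest = mid ++ suf := by
    have := (List.takeWhile_append_dropWhile (p := far) (l := rest.reverse)).symm
    rw [hmid, hsuf, ← List.reverse_append, ← this, List.reverse_reverse]
  obtain ⟨a, L', rfl⟩ := List.exists_cons_of_ne_nil hL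
  have hβne : β ≠ [] := by
    rw [hβ, List.takeWhile_cons_of_pos (by simpa using hhead)]; simp
  have hrestne : rest ≠ [] := by
    rw [hrest, Ne, List.dropWhile_eq_nil_iff]
    intro h
    obtain ⟨v, hv, hfv⟩ := hnear
    simpa [hfv] using h v hv
  have hresthead : far (rest.head hrestne) = false := by
    simpa using List.head_dropWhile_not far hrestne
  have hmidne' : rest.reverse.dropWhile far ≠ [] := by
    rw [Ne, List.dropWhile_eq_nil_iff]
    intro h
    have := h _ (List.mem_reverse.2 (List.head_mem hrestne))
    simp [hresthead] at this
  have hmidne : mid ≠ [] := by simpa [hmid] using hmidne'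
  have hrestlast : far (rest.getLast hrestne) = true := by
    have : (a :: L').getLast hL = rest.getLast hrestne := by
      simp only [hLβ]
      exact List.getLast_append_of_ne_nil _ hrestne
    rw [← this]; exact hlast
  have hsufne : suf ≠ [] := by
    have hne : rest.reverse ≠ [] := by simpa using hrestne
    obtain ⟨z, Z, hzZ⟩ := List.exists_cons_of_ne_nil hne
    have hz : far z = true := by
      have : rest.reverse.head hne = z := by simp [hzZ]
      rw [List.head_reverse] at this
      rw [← this]; exact hrestlast
    rw [hsuf, hzZ, List.takeWhile_cons_of_pos hz]; simp
  have hmidlast : ∀ h : mid ≠ [], far (mid.getLast h) = false := by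
    intro h
    simp only [hmid, List.getLast_reverse]
    simpa using List.head_dropWhile_not far hmidne'
  have hmidhead : ∀ h : mid ≠ [], far (mid.head h) = false := by
    intro h
    have : rest.head hrestne = mid.head h := by
      simp only [hrest_eq]; exact List.head_append_of_ne_nil _
    rw [← this]; exact hresthead
  refine ⟨hβne, hrestne, hmidne, hsufne, ?_, fun v hv => List.mem_takeWhile_imp hv,
    fun v hv => List.mem_takeWhile_imp (List.mem_reverse.1 hv), hmidhead, hmidlast⟩
  rw [← hrest_eq]; exact hLβ

/-- **The cut at the first near vertex (rooted case).** If the first element of `L` is far and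
some element is near, then `L = β ++ rest` with `β = takeWhile far L ≠ []` far and `rest ≠ []`
starting at a near element. [folklore] -/
theorem decomp_far_rooted {L : List V} (hL : L ≠ []) (hhead : far (L.head hL) = true)
    (hnear : ∃ v ∈ L, far v = false) :
    L.takeWhile far ≠ [] ∧ L.dropWhile far ≠ [] ∧ L = L.takeWhile far ++ L.dropWhile far ∧
    (∀ v ∈ L.takeWhile far, far v = true) ∧
    (∀ h : L.dropWhile far ≠ [], far ((L.dropWhile far).head h) = false) := by
  obtain ⟨a, L', rfl⟩ := List.exists_cons_of_ne_nil hL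
  have hβne : (a :: L').takeWhile far ≠ [] := by
    rw [List.takeWhile_cons_of_pos (by simpa using hhead)]; simp
  have hrestne : (a :: L').dropWhile far ≠ [] := by
    rw [Ne, List.dropWhile_eq_nil_iff]
    intro h
    obtain ⟨v, hv, hfv⟩ := hnear
    simpa [hfv] using h v hv
  exact ⟨hβne, hrestne, (List.takeWhile_append_dropWhile (p := far)).symm,
    fun v hv => List.mem_takeWhile_imp hv, fun h => by simpa using List.head_dropWhile_not far h⟩

end Decomp

/-! ### A far list followed by one point has no two vertex traversals -/

section NoTwo

variable {E : Type*} [PseudoMetricSpace E]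

/-- If no point of `l₁` lies in `B̄(x, r)` and `r < R`, the list `l₁ ++ [p]` does not have two weak
vertex traversals of `D(x; r, R)`. [folklore] -/
theorem not_vertexTraversals_far_append_singleton {l₁ : List E} {p x : E} {r R : ℝ} {k : ℕ}
    (hk : 2 ≤ k) (hrR : r < R) (h₁ : ∀ q ∈ l₁, r < dist q x)
    (h : ∃ ι κ : Fin k → Fin (l₁ ++ [p]).length, (∀ m, ι m ≤ κ m) ∧
      (∀ m, (dist ((l₁ ++ [p]).get (ι m)) x ≤ r ∧ R ≤ dist ((l₁ ++ [p]).get (κ m)) x) ∨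
        (R ≤ dist ((l₁ ++ [p]).get (ι m)) x ∧ dist ((l₁ ++ [p]).get (κ m)) x ≤ r)) ∧
      ∀ ⦃m m'⦄, m < m' → κ m ≤ ι m') : False := by
  obtain ⟨ι, κ, h1, h2, h3⟩ := h
  have hlen : ∀ i : Fin (l₁ ++ [p]).length, (i : ℕ) < l₁.length + 1 := fun i => by
    have h := i.isLt
    simp only [List.length_append, List.length_cons, List.length_nil] at h
    omega
  -- a near index is the last one
  have hnear : ∀ i : Fin (l₁ ++ [p]).length, dist ((l₁ ++ [p]).get i) x ≤ r →
      (i : ℕ) = l₁.length := by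
    intro i hi
    by_contra hne
    have hi' : (i : ℕ) < l₁.length := by have := hlen i; omega
    have : (l₁ ++ [p]).get i = l₁.get ⟨i, hi'⟩ := by
      simp only [List.get_eq_getElem]; exact List.getElem_append_left hi'
    rw [this] at hi
    exact absurd hi (not_le.2 (h₁ _ (List.get_mem _ _)))
  have hmax : ∀ i : Fin (l₁ ++ [p]).length, (i : ℕ) ≤ l₁.length := fun i => by
    have := hlen i; omega
  set m₀ : Fin k := ⟨0, by omega⟩
  set m₁ : Fin k := ⟨1, by omega⟩
  -- the same point cannot be near and far
  have hnf : ∀ i j : Fin (l₁ ++ [p]).length, (i : ℕ) = j → dist ((l₁ ++ [p]).get i) x ≤ r →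
      R ≤ dist ((l₁ ++ [p]).get j) x → False := by
    intro i j hij hi hj
    have : i = j := Fin.ext hij
    subst this
    linarith
  -- first traversal: its near index is `κ m₀`, the last index
  have hκ₀ : (κ m₀ : ℕ) = l₁.length := by
    rcases h2 m₀ with ⟨hi, hj⟩ | ⟨hi, hj⟩
    · have hι := hnear _ hi
      have : (κ m₀ : ℕ) = l₁.length := le_antisymm (hmax _) (hι ▸ (h1 m₀ : (ι m₀ : ℕ) ≤ κ m₀))
      exact (hnf _ _ (hι.trans this.symm) hi hj).elim
    · exact hnear _ hj
  -- second traversal: both indices are forced to be the last one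
  have hι₁ : (ι m₁ : ℕ) = l₁.length :=
    le_antisymm (hmax _) (hκ₀ ▸ (h3 (show m₀ < m₁ from Fin.mk_lt_mk.2 zero_lt_one) :
      (κ m₀ : ℕ) ≤ ι m₁))
  have hκ₁ : (κ m₁ : ℕ) = l₁.length :=
    le_antisymm (hmax _) (hι₁ ▸ (h1 m₁ : (ι m₁ : ℕ) ≤ κ m₁))
  rcases h2 m₁ with ⟨hi, hj⟩ | ⟨hi, hj⟩
  · exact hnf _ _ (hι₁.trans hκ₁.symm) hi hj
  · exact hnf _ _ (hκ₁.trans hι₁.symm) hj hi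

end NoTwo

/-! ### From the SAW polyline to vertex traversals; arcs through a door into `Ω_δ` -/

section Dictionary

variable {Ω : Set ℂ} {δ : ℝ} {a b : HexVertex}

/-- **The event on the polyline gives the event on the vertex sequence (lattice units).** If the
rescaled polyline of a SAW of `Ω_δ ⊆ δℍ` traverses `D(x; ρ₁, R₁)` by `k` separate segments, its
vertex sequence (face centres, lattice units) has `k` weak vertex traversals of
`D(x/δ; (ρ₁ + δ)/δ, (R₁ - δ)/δ)` (consecutive centres are `≤ δ` apart after rescaling).
[cite: AizenmanBurchard1999, §3.a (proof of Lemma 3.1)] -/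
theorem vertexTraversals_of_hasTraversals_toCurve (ω : HexDomainSAW Ω δ a b) (hδ : 0 < δ)
    (hedge : ∀ u v : HexVertex, hexGraph.Adj u v → dist (hexCenter u) (hexCenter v) ≤ 1)
    {k : ℕ} {x : ℂ} {ρ₁ R₁ : ℝ}
    (h : (⟨ω.walk.toCurve fun v => (δ : ℂ) * hexCenter v⟩ : Curve ℂ).HasTraversals k x ρ₁ R₁) :
    ∃ ι κ : Fin k → Fin (ω.walk.support.map hexCenter).length, (∀ m, ι m ≤ κ m) ∧
      (∀ m, (dist ((ω.walk.support.map hexCenter).get (ι m)) (x / δ) ≤ (ρ₁ + δ) / δ ∧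
          (R₁ - δ) / δ ≤ dist ((ω.walk.support.map hexCenter).get (κ m)) (x / δ)) ∨
        ((R₁ - δ) / δ ≤ dist ((ω.walk.support.map hexCenter).get (ι m)) (x / δ) ∧
          dist ((ω.walk.support.map hexCenter).get (κ m)) (x / δ) ≤ (ρ₁ + δ) / δ)) ∧
      ∀ ⦃m m'⦄, m < m' → κ m ≤ ι m' := by
  set f : HexVertex → ℂ := fun v => (δ : ℂ) * hexCenter v with hf
  have hsupp : ω.walk.support = a :: ω.walk.support.tail := (ω.walk.cons_tail_support).symm
  have h' : (⟨polyline (f a :: ω.walk.support.tail.map f)⟩ : Curve ℂ).HasTraversals k x ρ₁ R₁ := by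
    have e : ω.walk.toCurve f = polyline (f a :: ω.walk.support.tail.map f) := by
      rw [SimpleGraph.Walk.toCurve, hsupp, List.map_cons, ← hsupp]
    rw [← e]; exact h
  have hchain : List.IsChain (fun p q => dist p q ≤ δ) (f a :: ω.walk.support.tail.map f) := by
    rw [← List.map_cons, ← hsupp, List.isChain_map]
    refine ω.walk.isChain_adj_support.imp fun u v huv => ?_
    have h1 := hedge u v (embDomainGraph_le _ _ _ _ huv)
    simp only [hf, dist_eq_norm, ← mul_sub, norm_mul, Complex.norm_real, Real.norm_of_nonneg hδ.le]
    rw [← dist_eq_norm]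
    nlinarith
  have hv := vertexTraversals_of_hasTraversals_polyline hδ.le hchain h'
  rw [← List.map_cons, ← hsupp] at hv
  have hmap : ω.walk.support.map f = (ω.walk.support.map hexCenter).map (fun p : ℂ => (δ : ℂ) * p) := by
    rw [List.map_map]; rfl
  rw [hmap] at hv
  have hδ' : (δ : ℂ) ≠ 0 := by exact_mod_cast hδ.ne'
  refine vertexTraversals_of_map (f := fun p : ℂ => (δ : ℂ) * p) hδ (fun p => ?_) hv
  rw [show (x : ℂ) = (δ : ℂ) * (x / δ) by field_simp, dist_eq_norm, ← mul_sub, norm_mul,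
    Complex.norm_real, Real.norm_of_nonneg hδ.le, ← dist_eq_norm, mul_div_cancel_left₀ _ hδ']

/-- **Arcs through a door into `Ω_δ` using mesh edges are arcs of `Ω_δ`.** Enlarge the graph `Ω_δ`
by all edges of `ℍ` between cells of the closed `(N+1)`-disc about `z₀`, whose rescaled copy lies
in `Ω`. A self-avoiding arc of a vertex set `Λ'' ∌ u` entering through the door `{u, c}` with `c` a
vertex of `Ω_δ` uses only edges of the enlarged graph iff it uses only edges of `Ω_δ` (its first
vertex is `c`, and `Ω_δ` is closed under mesh adjacency). [folklore] -/
theorem isChain_sup_disc_iff (hδ : 0 < δ) {z₀ : ℂ} {N : ℝ}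
    (hΩ : Metric.closedBall ((δ : ℂ) * z₀) (δ * (N + 1)) ⊆ Ω) {Λ'' : Finset HexVertex}
    {u c : HexVertex} {m' : Sym2 HexVertex} (hu : u ∉ Λ'')
    (hc : c ∈ embMeshDomain hexGraph hexCenter Ω δ) (α : HexMidEdgeSAW Λ'' s(u, c) m') :
    α.verts.IsChain (hexDomainGraph Ω δ ⊔ SimpleGraph.fromRel (fun p q => hexGraph.Adj p q ∧
      dist (hexCenter p) z₀ ≤ N + 1 ∧ dist (hexCenter q) z₀ ≤ N + 1)).Adj ↔
      α.verts.IsChain (hexDomainGraph Ω δ).Adj := by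
  refine ⟨fun h => ?_, fun h => h.imp fun p q hpq => (SimpleGraph.sup_adj _ _ _ _).2 (Or.inl hpq)⟩
  have hdist : ∀ p : HexVertex, dist (hexCenter p) z₀ ≤ N + 1 →
      (δ : ℂ) * hexCenter p ∈ Metric.closedBall ((δ : ℂ) * z₀) (δ * (N + 1)) := fun p hp => by
    rw [Metric.mem_closedBall, dist_eq_norm, ← mul_sub, norm_mul, Complex.norm_real,
      Real.norm_of_nonneg hδ.le, ← dist_eq_norm]
    exact mul_le_mul_of_nonneg_left hp hδ.le
  have hmesh : ∀ p q : HexVertex, hexGraph.Adj p q → dist (hexCenter p) z₀ ≤ N + 1 →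
      dist (hexCenter q) z₀ ≤ N + 1 → (embMeshGraph hexGraph hexCenter Ω δ).Adj p q ∧
        q ∈ embMeshVertices hexCenter Ω δ := fun p q hpq hp hq =>
    ⟨(embMeshGraph_adj_iff _ _).2 ⟨hpq, ((convex_closedBall _ _).segment_subset (hdist p hp)
      (hdist q hq)).trans (hΩ.trans subset_closure)⟩, (mem_embMeshVertices_iff _).2 (hΩ (hdist q hq))⟩
  refine isChain_embDomainGraph_of_isChain (fun p q hpq => ?_) h (fun hne => ?_)
  · rcases (SimpleGraph.sup_adj _ _ _ _).1 hpq with hpq | hpq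
    · obtain ⟨hm, -, hq⟩ := (embDomainGraph_adj_iff _ _).1 hpq
      exact ⟨hm, embMeshDomain_subset _ _ _ _ hq⟩
    · obtain ⟨-, ⟨hadj, hp, hq⟩ | ⟨hadj, hq, hp⟩⟩ := (SimpleGraph.fromRel_adj _ _ _).1 hpq
      · exact hmesh p q hadj hp hq
      · exact hmesh p q hadj.symm hp hq
  · have h1 := α.head_mem _ (List.head?_eq_some_head hne)
    rcases Sym2.mem_iff.1 h1 with h2 | h2
    · exact absurd (h2 ▸ α.subset _ (List.head_mem hne)) hu
    · rw [h2]; exact hc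

end Dictionary

/-! ### Supports, filters and reversal of the walks -/

section Reversal

variable {Ω : Set ℂ} {δ : ℝ} {a b : HexVertex}

/-- Every vertex of a SAW of `Ω_δ` with distinct endpoints lies in the discrete domain `Ω_δ`
(the first vertex through its first edge, the others as heads of darts). [folklore] -/
theorem support_subset_embMeshDomain_of_ne (ω : HexDomainSAW Ω δ a b) (hab : a ≠ b) :
    ∀ v ∈ ω.walk.support, v ∈ embMeshDomain hexGraph hexCenter Ω δ := by
  intro v hv
  rcases (SimpleGraph.Walk.mem_support_iff _).1 hv with rfl | hv
  · exact ((embDomainGraph_adj_iff _ _).1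
      (ω.walk.adj_snd (SimpleGraph.Walk.not_nil_of_ne hab))).2.1
  · rw [← SimpleGraph.Walk.map_snd_darts] at hv
    obtain ⟨d, -, rfl⟩ := List.mem_map.1 hv
    exact ((embDomainGraph_adj_iff _ _).1 d.adj).2.2

/-- Membership in a filter of `Finset.univ`, for an arbitrary decidability instance (the filters
in the conclusions of the virginization lemmas carry their own instances). [folklore] -/
theorem mem_filter_univ_of_pred {α : Type*} [Fintype α] {p : α → Prop} {dp : DecidablePred p}
    {c : α} (h : p c) : c ∈ @Finset.filter α p dp Finset.univ :=
  (@Finset.mem_filter α p dp Finset.univ c).2 ⟨Finset.mem_univ _, h⟩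

/-- **Reversal of the walks.** A bound `≤ C ·(total mass)` for the `x^{#vertices}`-mass of the SAWs
`b → a` whose support satisfies an event `E` gives the same bound for a finite set containing the
SAWs `a → b` whose REVERSED support satisfies `E` (reversal is a weight-preserving bijection,
`sum_support_eq_sum_reverse`). [folklore] -/
theorem exists_reverse_event_le [Fintype (HexDomainSAW Ω δ a b)] [Fintype (HexDomainSAW Ω δ b a)]
    {E : List HexVertex → Prop} {dE : DecidablePred fun ω : HexDomainSAW Ω δ b a => E ω.walk.support}
    {x C : ℝ}
    (h : ∑ ω ∈ @Finset.filter _ (fun ω : HexDomainSAW Ω δ b a => E ω.walk.support) dE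
        Finset.univ, x ^ ω.vertexCount ≤ C * ∑ ω : HexDomainSAW Ω δ b a, x ^ ω.vertexCount) :
    ∃ S : Finset (HexDomainSAW Ω δ a b),
      ∑ ω ∈ S, x ^ ω.vertexCount ≤ C * ∑ ω : HexDomainSAW Ω δ a b, x ^ ω.vertexCount ∧
      ∀ ω : HexDomainSAW Ω δ a b, E ω.walk.support.reverse → ω ∈ S := by
  refine ⟨Finset.univ.filter (fun ω => E ω.walk.support.reverse), ?_,
    fun ω hω => Finset.mem_filter.2 ⟨Finset.mem_univ _, hω⟩⟩
  rw [Finset.sum_filter] at h ⊢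
  simp only [vertexCount_eq_length_support] at h ⊢
  rw [sum_support_eq_sum_reverse (fun L : List HexVertex => if E L.reverse then x ^ L.length else 0),
    sum_support_eq_sum_reverse (fun L : List HexVertex => x ^ L.length)]
  simp only [List.reverse_reverse, List.length_reverse]
  exact (Finset.sum_congr rfl fun ω _ => if_congr Iff.rfl rfl rfl).trans_le h

end Reversal

end Literature.Probability.RandomPlanarGeometry.SAW

end
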